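import Literature.Analysis.FluidPDE.TaoCascadeOperator
import Literature.Analysis.FluidPDE.TaoCascadeODEProofs
import Literature.Analysis.FluidPDE.TaoCascadeWaveletData
import HarnessLib

/-!
# Tao's averaged Navier–Stokes blow-up: Lemma 4.1 (equations of motion) and Theorem 3.3 from Theorem 4.2

T. Tao, *Finite time blowup for an averaged three-dimensional Navier–Stokes equation*,
J. Amer. Math. Soc. **29** (2016), 601–674 = arXiv:1402.0290v3 (held as `paper:arxiv-1402.0290`;
all numbers are those of that text), §4, pp. 21–23: the datum (4.4) `u₀ = ψ_{1,n₀}`, the Fourier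
projections `u_{i,n}`, coefficients `X_{i,n} = ⟨u, ψ_{i,n}⟩` and local energies
`E_{i,n} = ½‖u_{i,n}‖²` (4.5), **Lemma 4.1** (equations of motion), and the sentence "Theorem 3.3
now follows from the following ODE result" (Theorem 4.2).

Contents:

* `schwartzWavelet` — the datum `ψ_{i₀,n₀}` as a Schwartz field (`schwartzL2_schwartzWavelet`: its
  `L²` class is the accepted `cascadeWavelet`; `isDivFree_schwartzWavelet`: it is divergence free);
* `modeProjection`, `modeCoeff`, `modeEnergy` — `u_{i,n}`, `X_{i,n}`, `E_{i,n}` of Lemma 4.1;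
* `equationsOfMotion` — **Lemma 4.1** as a named fact, with conclusions the accepted
  `TaoCascade.CascadeODESolution` ((4.6)–(4.13));
* `localCascade_blowup_of_equationsOfMotion` — **Theorem 3.3 ⇐ Lemma 4.1 + Theorem 4.2**, proved
  (the wavelet data of §4 p. 21 exist: accepted `nonempty_cascadeWaveletData`,
  `TaoCascadeWaveletData.lean`);
* `averagedNS_blowup_of_leaves` — the whole reduction chain of the paper assembled:
  **Theorem 1.5** (`averagedNS_blowup`) **⇐ Theorem 3.2 + Lemma 4.1 + Theorem 6.2**, using the
  proved links `averagedNS_blowup_of_cascade` (§3), this file (§4) and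
  `TaoCascade.odeBlowup_of_noGlobalODESolution` (§6.1). These three analytic results of the paper
  are exactly the current trust base of the corrected in-tree statement of Tao's theorem.

## Design notes

* `X_{i,n}(t)` is the real part of the (complex-bilinear) pairing `⟨u(t), ψ_{i,n}⟩`; for the real
  fields of a mild solution and the real wavelets the pairing is real.
* The Fourier projection to `(1+ε₀)ⁿ·(Bᵢ ∪ -Bᵢ)` is the accepted `fourierMultiplier` with the
  indicator symbol; the region is written as a preimage under `ξ ↦ (1+ε₀)⁻ⁿ ξ` (open, measurable).
* Lemma 4.1's implied constants: the proof (p. 22) bounds the `O()` terms of (4.10), (4.12) by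
  `(1+ε₀)^{2n} E_{i,n}^{1/2} · ‖Δψᵢ‖_{L²}` and its consequences (`K₁ = √2 maxᵢ ‖Δψᵢ‖_{L²}`,
  `K₂ = √2 K₁`), so they depend on `ε₀` and the data only; the fact lets them depend on `ε₀`, the
  data and `α` (`∃ K₁ K₂` after `α`, before `∀ i₀ n₀ u`), which is at most the printed strength —
  this uniformity in `n₀` and `u` is what Theorem 4.2 ("`n₀` sufficiently large depending on the
  implied constants") consumes. The datum mode `i₀` is general (Tao: `i₀ = 1`; a relabelling of the modes, as in the
  accepted `TaoCascade.CascadeODESolution`).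
* Values of `u`, `X`, `E` at `t < 0` are irrelevant (every clause of `CascadeODESolution` is on
  `[0,+∞)`).

## References

* T. Tao, J. Amer. Math. Soc. 29 (2016), 601–674, arXiv:1402.0290v3, §4 pp. 21–23 ((4.4), (4.5),
  Lemma 4.1, Thm 4.2), §3 Thm 3.3, §6.1. Key `Tao2016AveragedNS`.
-/

noncomputable section

open MeasureTheory Set Filter FourierTransform
open scoped ENNReal NNReal SchwartzMap

namespace Literature.Analysis.FluidPDE.Tao2016

/-- Local notation for physical / frequency space `ℝ³`. -/
local notation "ℝ³" => EuclideanSpace ℝ (Fin 3)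
/-- Local notation for the complexified range `ℂ³`. -/
local notation "ℂ³" => EuclideanSpace ℂ (Fin 3)

/-! ### The initial datum `u₀ = ψ_{i₀,n₀}` as a Schwartz field -/

/-- The wavelet `ψₙ(x) = (1+ε₀)^{3n/2} ψ((1+ε₀)ⁿ x)` as a **Schwartz** field (the initial datum
(4.4), `u₀ := ψ_{1,n₀}`, is of this form): `Dil_{(1+ε₀)ⁿ} ψ`. [cite: Tao2016AveragedNS, §4 (4.4)] -/
def schwartzWavelet {ε₀ : ℝ} (hε₀ : 0 < 1 + ε₀) (ψ : 𝓢(ℝ³, ℝ³)) (n : ℤ) : 𝓢(ℝ³, ℝ³) :=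
  schwartzDil (Units.mk0 ((1 + ε₀) ^ n) (zpow_ne_zero n hε₀.ne')) ψ

/-- The `L²` class of the Schwartz wavelet is the `L²` wavelet `cascadeWavelet`. [cite: Tao2016AveragedNS, §4 (4.4)] -/
theorem schwartzL2_schwartzWavelet {ε₀ : ℝ} (hε₀ : 0 < 1 + ε₀) (ψ : 𝓢(ℝ³, ℝ³)) (n : ℤ) :
    schwartzL2 (schwartzWavelet hε₀ ψ n) = cascadeWavelet ε₀ ψ n := by
  rw [schwartzWavelet, schwartzL2_schwartzDil, Units.val_mk0, cascadeWavelet]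

/-- Dilation preserves divergence-freeness: `div (c^{3/2} ψ(c ·)) = c^{5/2} (div ψ)(c ·) = 0`. [folklore] -/
theorem isDivFree_schwartzDil (c : ℝˣ) {ψ : 𝓢(ℝ³, ℝ³)} (hψ : VectorCalculus.IsDivFree ⇑ψ) :
    VectorCalculus.IsDivFree ⇑(schwartzDil c ψ) := by
  intro x
  unfold VectorCalculus.divergence
  have h1 : HasFDerivAt (fun y : ℝ³ => (c : ℝ) • y) ((c : ℝ) • ContinuousLinearMap.id ℝ ℝ³) x :=
    (hasFDerivAt_id x).const_smul (c : ℝ)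
  have h2 : HasFDerivAt (⇑ψ) (fderiv ℝ (⇑ψ) ((c : ℝ) • x)) ((c : ℝ) • x) :=
    ψ.differentiableAt.hasFDerivAt
  have h3 : HasFDerivAt (⇑(schwartzDil c ψ))
      (((c : ℝ) ^ ((3 : ℝ) / 2)) •
        (fderiv ℝ (⇑ψ) ((c : ℝ) • x)).comp ((c : ℝ) • ContinuousLinearMap.id ℝ ℝ³)) x :=
    (h2.comp x h1).const_smul ((c : ℝ) ^ ((3 : ℝ) / 2))
  have hcomp : (fderiv ℝ (⇑ψ) ((c : ℝ) • x)).comp ((c : ℝ) • ContinuousLinearMap.id ℝ ℝ³) =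
      (c : ℝ) • fderiv ℝ (⇑ψ) ((c : ℝ) • x) := by
    ext y
    simp
  have hψ' : LinearMap.trace ℝ ℝ³ (fderiv ℝ (⇑ψ) ((c : ℝ) • x) : ℝ³ →ₗ[ℝ] ℝ³) = 0 := hψ _
  rw [h3.fderiv, hcomp, smul_smul, ContinuousLinearMap.toLinearMap_smul, LinearMap.map_smul, hψ',
    smul_zero]

/-- The Schwartz wavelets of a divergence-free profile are divergence free (so `u₀ = ψ_{1,n₀}`
is "clearly a Schwartz divergence-free vector field", Tao 2016, p. 21). [cite: Tao2016AveragedNS, §4 (4.4)] -/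
theorem isDivFree_schwartzWavelet {ε₀ : ℝ} (hε₀ : 0 < 1 + ε₀) {ψ : 𝓢(ℝ³, ℝ³)}
    (hψ : VectorCalculus.IsDivFree ⇑ψ) (n : ℤ) :
    VectorCalculus.IsDivFree ⇑(schwartzWavelet hε₀ ψ n) :=
  isDivFree_schwartzDil _ hψ

/-! ### The Fourier projections, coefficients and local energies of Lemma 4.1 -/

/-- The constant symbol `1` on a measurable frequency set `s` (and `0` off it) is an `L^∞`
function (Mathlib's `memLp_top_const` and `MemLp.indicator`): the symbol of the Fourier
projection to `s`. [folklore] -/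
theorem memLp_top_indicator_one {s : Set ℝ³} (hs : MeasurableSet s) :
    MemLp (s.indicator fun _ => (1 : ℂ)) ∞ (volume : Measure ℝ³) :=
  (memLp_top_const (1 : ℂ)).indicator hs

variable {ε₀ : ℝ} {m : ℕ}

/-- The frequency region `(1+ε₀)ⁿ · (Bᵢ ∪ -Bᵢ)` of the mode `(i, n)` (Tao 2016, Lemma 4.1),
written as the preimage of `Bᵢ ∪ -Bᵢ` under `ξ ↦ (1+ε₀)⁻ⁿ ξ`. [cite: Tao2016AveragedNS, Lemma 4.1] -/
def freqRegion (𝒟 : CascadeWaveletData ε₀ m) (i : Fin m) (n : ℤ) : Set ℝ³ :=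
  (fun ξ : ℝ³ => ((1 + ε₀) ^ n)⁻¹ • ξ) ⁻¹'
    (Metric.ball (𝒟.center i) (𝒟.radius i) ∪ -Metric.ball (𝒟.center i) (𝒟.radius i))

/-- The frequency regions are open, hence measurable. [folklore] -/
theorem measurableSet_freqRegion (𝒟 : CascadeWaveletData ε₀ m) (i : Fin m) (n : ℤ) :
    MeasurableSet (freqRegion 𝒟 i n) :=
  ((Metric.isOpen_ball.union Metric.isOpen_ball.neg).preimage
    (continuous_const_smul _)).measurableSet

/-- The **Fourier projection** `u_{i,n}` of `u ∈ L²` to the region `(1+ε₀)ⁿ · (Bᵢ ∪ -Bᵢ)`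
(Tao 2016, Lemma 4.1: `\widehat{u_{i,n}}(ξ) = û(ξ) 1_{ξ ∈ (1+ε₀)ⁿ·(Bᵢ ∪ -Bᵢ)}`), as the accepted
`fourierMultiplier` with indicator symbol. [cite: Tao2016AveragedNS, Lemma 4.1] -/
def modeProjection (𝒟 : CascadeWaveletData ε₀ m) (i : Fin m) (n : ℤ) (u : L2C) : L2C :=
  fourierMultiplier ((memLp_top_indicator_one (measurableSet_freqRegion 𝒟 i n)).toLp _) u

/-- The **coefficients** `X_{i,n}(t) = ⟨u(t), ψ_{i,n}⟩` of Lemma 4.1 (real: `u(t)` and `ψ_{i,n}`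
are real fields, and the pairing of real fields is real; the real part is taken to land in `ℝ`). [cite: Tao2016AveragedNS, Lemma 4.1] -/
def modeCoeff (𝒟 : CascadeWaveletData ε₀ m) (u : ℝ → L2C) (i : Fin m) (n : ℤ) (t : ℝ) : ℝ :=
  (pairing (u t) (cascadeWavelet ε₀ (𝒟.ψ i) n)).re

/-- The **local energies** `E_{i,n}(t) = ½ ‖u_{i,n}(t)‖²_{L²(ℝ³)}` of Lemma 4.1, (4.5). [cite: Tao2016AveragedNS, Lemma 4.1 (4.5)] -/
def modeEnergy (𝒟 : CascadeWaveletData ε₀ m) (u : ℝ → L2C) (i : Fin m) (n : ℤ) (t : ℝ) : ℝ :=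
  ‖modeProjection 𝒟 i n (u t)‖ ^ 2 / 2

/-- The local energies are non-negative. [folklore] -/
theorem modeEnergy_nonneg (𝒟 : CascadeWaveletData ε₀ m) (u : ℝ → L2C) (i : Fin m) (n : ℤ)
    (t : ℝ) : 0 ≤ modeEnergy 𝒟 u i n t := by
  unfold modeEnergy
  positivity

/-! ### Lemma 4.1 as a named fact -/

/-- **Tao 2016, Lemma 4.1 (Equations of motion)**, as printed (pp. 21–22): *Let `C` be a cascade
operator of the form (4.1), with coefficients `α_{i₁,i₂,i₃,μ₁,μ₂,μ₃}` obeying the symmetry (4.2)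
and cancellation property (4.3). Let `u : [0,+∞) → H¹⁰_df(ℝ³)` be a global mild solution to the
equation (3.3) with initial data given by (4.4) for some `n₀`. For each `n ∈ ℤ`, `t ≥ 0` and
`i = 1, …, m`, let `u_{i,n}(t)` be the Fourier projection of `u(t)` to the region
`(1+ε₀)ⁿ · (Bᵢ ∪ -Bᵢ)`, `X_{i,n}(t) := ⟨u(t), ψ_{i,n}⟩` and `E_{i,n}(t) := ½ ‖u_{i,n}(t)‖²_{L²}`.
Then (i) a priori regularity (4.6), (4.7); (ii) initial conditions (4.8), (4.9); (iii) the
equation of motion (4.10) and the energy inequality (4.11); (iv) the energy defect (4.12);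
(v) no very low frequencies (4.13)* — i.e. `X_{i,n}, E_{i,n}` are continuously differentiable on
`[0,+∞)` and obey the accepted `TaoCascade.CascadeODESolution` (which transcribes (4.6)–(4.13)),
with implied constants `K₁, K₂ ≥ 0` depending on `ε₀`, the data and `α` — in fact only on `ε₀` and
the data (the proof bounds them by `maxᵢ ‖Δψᵢ‖_{L²}`, p. 22) — but not on `n₀` or `u`: the
uniformity used by Theorem 4.2. The datum mode
is written `i₀` (Tao takes `i₀ = 1`; any mode may carry the datum, by relabelling). Proved in the
source from the mild formulation, Plancherel, the local energy inequality and Gronwall (p. 22–23).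
A `Prop`-valued definition, not asserted. [cite: Tao2016AveragedNS, Lemma 4.1] -/
def equationsOfMotion : Prop :=
  ∀ (ε₀ : ℝ), 0 < ε₀ → ε₀ < 1 → ∀ (m : ℕ) (𝒟 : CascadeWaveletData ε₀ m)
    (α : Fin m → Fin m → Fin m → ℤ × ℤ × ℤ → ℝ),
    TaoCascade.IsSymmetricCoeff α → TaoCascade.IsCancellingCoeff α →
      ∃ K₁ K₂ : ℝ, 0 ≤ K₁ ∧ 0 ≤ K₂ ∧ ∀ (i₀ : Fin m) (n₀ : ℤ) (u : ℝ → L2C),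
        IsMildSolutionFor (cascadeOperatorForm ε₀ 𝒟.ψ α) (cascadeWavelet ε₀ (𝒟.ψ i₀) n₀)
            (Ici 0) u →
          TaoCascade.CascadeODESolution ε₀ i₀ α K₁ K₂ n₀ (modeCoeff 𝒟 u) (modeEnergy 𝒟 u)

/-! ### Theorem 3.3 from Lemma 4.1 and Theorem 4.2 -/

/-- **Theorem 3.3 ⇐ Lemma 4.1 + Theorem 4.2** (Tao 2016, §4, pp. 21–23: "We suppose that
Theorem 3.3 failed … Theorem 3.3 now follows from the following ODE result [Theorem 4.2]").
For `0 < ε₀ < 1`, Theorem 4.2 (accepted `TaoCascade.odeBlowup`) supplies `m`, a datum mode `i₀`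
and structure constants `α` obeying (4.2), (4.3); wavelet data `𝒟` exist (accepted
`nonempty_cascadeWaveletData`), and with them the cascade operator (4.1) is a symmetric local
cascade operator with cancellation (`isLocalCascadeForm_cascadeOperatorForm`,
`cascadeOperatorForm_symm`, `cascadeOperatorForm_cancel`); Lemma 4.1 gives the implied constants
`K₁, K₂`, Theorem 4.2 a threshold `N₀`, and with `n₀ = N₀`, `u₀ = ψ_{i₀,n₀}` (Schwartz and
divergence free) a global mild solution would produce, by Lemma 4.1, functions `X_{i,n}, E_{i,n}`
that Theorem 4.2 excludes. [cite: Tao2016AveragedNS, §4 pp. 21–23] -/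
theorem localCascade_blowup_of_equationsOfMotion (h41 : equationsOfMotion)
    (h42 : TaoCascade.odeBlowup) : localCascade_blowup := by
  intro ε₀ hε₀ hε₀1
  have hl : (0 : ℝ) < 1 + ε₀ := by positivity
  obtain ⟨m, i₀, α, hsymm, hcanc, h42⟩ := h42 ε₀ hε₀ hε₀1
  obtain ⟨𝒟⟩ := nonempty_cascadeWaveletData hε₀ m
  obtain ⟨K₁, K₂, hK₁, hK₂, h41⟩ := h41 ε₀ hε₀ hε₀1 m 𝒟 α hsymm hcanc
  obtain ⟨N₀, hN₀⟩ := h42 K₁ K₂ hK₁ hK₂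
  refine ⟨cascadeOperatorForm ε₀ 𝒟.ψ α, isLocalCascadeForm_cascadeOperatorForm hε₀ hε₀1.le 𝒟 α,
    fun u v w _ _ _ => cascadeOperatorForm_symm ε₀ 𝒟.ψ hsymm u v w,
    fun u _ => cascadeOperatorForm_cancel ε₀ 𝒟.ψ hcanc u,
    schwartzWavelet hl (𝒟.ψ i₀) N₀, isDivFree_schwartzWavelet hl (𝒟.isDivFree i₀) N₀, ?_⟩
  rintro ⟨u, hu⟩
  rw [schwartzL2_schwartzWavelet] at hu
  exact hN₀ N₀ le_rfl ⟨_, _, h41 i₀ N₀ u hu⟩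

/-- **The reduction chain of the paper, assembled** (Tao 2016: §3 "Theorem 1.5 is then an
immediate consequence of [Theorems 3.2, 3.3]"; §4 "Theorem 3.3 now follows from [Theorem 4.2]"
via Lemma 4.1; §6.1 "To prove Theorem 4.2, it thus suffices to show Theorem 6.2"):
Theorem 1.5 (`averagedNS_blowup`) follows from the three named facts Theorem 3.2
(`localCascade_isAveraged`), Lemma 4.1 (`equationsOfMotion`) and Theorem 6.2
(`TaoCascade.noGlobalODESolution`), all other links (and the wavelet data) being proved in the
tree. [cite: Tao2016AveragedNS, Thm. 1.5] -/
theorem averagedNS_blowup_of_leaves (h32 : localCascade_isAveraged) (h41 : equationsOfMotion)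
    (h62 : TaoCascade.noGlobalODESolution) : averagedNS_blowup :=
  averagedNS_blowup_of_cascade h32
    (localCascade_blowup_of_equationsOfMotion h41 (TaoCascade.odeBlowup_of_noGlobalODESolution h62))

end Literature.Analysis.FluidPDE.Tao2016
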